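import Literature.NumberTheory.CubicFields.CubicFieldCount
import Literature.NumberTheory.CubicFields.MaximalCubicRings
import HarnessLib

/-!
# `N₃^±(X)` as a count of `GL₂(ℤ)`-orbits of irreducible, everywhere-maximal binary cubic forms

Topic `Literature/NumberTheory/CubicFields`; the junction of `CubicFieldCount.lean`
(`cubicFieldCount s X = N₃^±(X)`, the injection `orbitOfClass` of isomorphism classes of cubic
fields into `GL₂(ℤ)`-orbits on `V(ℤ)`) and `MaximalCubicRings.lean` (`R(f) ≅ 𝓞 K` for a cubic
number field iff `f` is irreducible and `f ∈ U_p` for all `p`).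

Bhargava–Taniguchi–Thorne 2023, §2.2 (after Prop. 2.2): Davenport–Heilbronn count cubic fields by
counting `GL₂(ℤ)`-orbits of integral binary cubic forms: by the Levi–Delone–Faddeev correspondence
(Thm 2.1) and the maximality criterion (Prop. 2.2), isomorphism classes of cubic fields `K` with
`0 < ±Disc(K) < X` correspond exactly to the `GL₂(ℤ)`-orbits of IRREDUCIBLE forms `f` lying in
`U_p` for every prime `p`, with `0 < ±Disc(f) < X`. This file proves exactly that:

* `range_orbitOfClass` — **the image of {cubic fields with `0 < s·Disc < X`}/≅ → `GL₂(ℤ)\V(ℤ)`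
  is the set of orbits of irreducible `f` with `f ∈ U_p` for all primes `p` and `0 < s·Disc(f) < X`**;
* `cubicFieldCount_eq_card_orbits` — **`N₃^±(X) = #{such orbits}`** (the Davenport–Heilbronn
  reformulation of the count of cubic fields).

## References

* M. Bhargava, T. Taniguchi, F. Thorne, *Improved error estimates for the Davenport–Heilbronn
  theorems*, Math. Ann. 389 (2024) = arXiv:2107.12819, §2.2 [BhargavaTaniguchiThorne2023].
* H. Davenport, H. Heilbronn, *On the density of discriminants of cubic fields. II*, Proc. Roy.
  Soc. London A 322 (1971) 405–420 [DavenportHeilbronn1971].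
-/

namespace Literature.NumberTheory.CubicFields

open NumberField BinaryCubic RingOfForm

/-- **The Davenport–Heilbronn orbits**: the `GL₂(ℤ)`-orbits of irreducible integral binary cubic
forms `f` with `f ∈ U_p` for every prime `p` and `0 < s · Disc(f) < X`. [cite: BhargavaTaniguchiThorne2023, §2.2 (orbits of irreducible forms maximal at all p)] -/
def dhOrbits (s : ℤ) (X : ℝ) : Set (Set (BinaryCubic ℤ)) :=
  {O | ∃ f : BinaryCubic ℤ, O = gl2zOrbit f ∧ f.IsIrreducible ∧ (∀ p : ℕ, p.Prime → f.MemU p) ∧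
    0 < s * f.disc ∧ ((s * f.disc : ℤ) : ℝ) < X}

/-- **The image of the injection {cubic fields}/≅ → orbits is the set of Davenport–Heilbronn
orbits** (BTT 2023, §2.2 with Thm 2.1 and Prop. 2.2): the orbit of a cubic field `K` consists of
irreducible forms in every `U_p` with `Disc = Disc(K)`; conversely an irreducible `f` in every `U_p`
has `R(f) ≅ 𝓞 K_f` maximal, and `K_f` is a cubic field with `Disc(K_f) = Disc(f)` whose orbit is
that of `f`. [cite: BhargavaTaniguchiThorne2023, §2.2 (cubic fields ↔ GL₂(ℤ)-orbits of irreducible binary cubic forms in U_p for all p)] -/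
theorem range_orbitOfClass (s : ℤ) (X : ℝ) :
    Set.range (orbitOfClass (s := s) (X := X)) = dhOrbits s X := by
  ext O
  constructor
  · rintro ⟨c, rfl⟩
    induction c using Quotient.inductionOn with | h K => ?_
    change orbitOfField K ∈ dhOrbits s X
    obtain ⟨eK⟩ := nonempty_ringEquiv_chosenForm K
    set f₀ := (exists_ringOfForm_ringEquiv_ringOfIntegers (K : FiniteSubfield) K.2.1).choose
    have hdisc : f₀.disc = discr (K : FiniteSubfield) := disc_eq_discr_of_ringEquiv_ringOfIntegers K.2.1 eK
    refine ⟨f₀, rfl, isIrreducible_of_ringEquiv_ringOfIntegers eK,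
      fun p hp => memU_of_ringEquiv_ringOfIntegers eK hp.one_lt, ?_, ?_⟩
    · rw [hdisc]; exact K.2.2.1
    · rw [hdisc]; exact K.2.2.2
  · rintro ⟨f, rfl, hirr, hU, h0, hX⟩
    haveI : Fact f.IsIrreducible := ⟨hirr⟩
    -- `R(f) ≅ 𝓞 K_f`, `K_f` a cubic field with `Disc(K_f) = Disc(f)`
    have e : RingOfForm f ≃+* 𝓞 (RatAlgebra f) := ringEquivRingOfIntegers (isMaximal_of_memU hU)
    have hdisc : f.disc = discr (RatAlgebra f) := disc_eq_discr_of_ringEquiv_ringOfIntegers finrank_ratAlgebra_eq_three e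
    rw [hdisc] at h0 hX
    obtain ⟨F, hF, ⟨φ⟩⟩ := exists_mem_cubicSubfields_algEquiv (RatAlgebra f) finrank_ratAlgebra_eq_three h0 hX
    refine ⟨Quotient.mk _ ⟨F, hF⟩, ?_⟩
    change orbitOfField ⟨F, hF⟩ = gl2zOrbit f
    obtain ⟨eF⟩ := nonempty_ringEquiv_chosenForm (⟨F, hF⟩ : cubicSubfields s X)
    exact gl2zOrbit_eq_iff.mpr (gl2zEquiv_of_ringEquiv_ringOfIntegers_of_ringEquiv eF e φ.symm.toRingEquiv)

/-- **`N₃^±(X)` is the number of Davenport–Heilbronn orbits**: the number of isomorphism classes of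
cubic fields `K` with `0 < ±Disc(K) < X` equals the number of `GL₂(ℤ)`-orbits of irreducible
integral binary cubic forms `f` with `f ∈ U_p` for all primes `p` and `0 < ±Disc(f) < X`
(BTT 2023, §2.2; Davenport–Heilbronn). [cite: BhargavaTaniguchiThorne2023, §2.2 (N₃(X) as a count of GL₂(ℤ)-orbits of maximal irreducible forms)] -/
theorem cubicFieldCount_eq_card_dhOrbits (s : ℤ) [Fact (s = 1 ∨ s = -1)] (X : ℝ) :
    cubicFieldCount s X = Nat.card (dhOrbits s X) := by
  rw [cubicFieldCount_eq_card_range_orbitOfClass, range_orbitOfClass]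

/-- In particular the set of Davenport–Heilbronn orbits with `0 < s·Disc < X` is finite (Hermite,
through the fields). [folklore] -/
theorem dhOrbits_finite (s : ℤ) [Fact (s = 1 ∨ s = -1)] (X : ℝ) : (dhOrbits s X).Finite := by
  rw [← range_orbitOfClass]
  exact Set.finite_range _

end Literature.NumberTheory.CubicFields
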